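import Mathlib
import Summits.Ventures.PercRepro.TriangleCapRowPlusTwoCases

/-!
# PercRepro — the degrees in the graph off a vertex, and the defect sum seen from a second vertex `c`
(p3, gen 31; part 6 — towards the row `m = k + 3`)

With `R = offPairs D v`, `E′ = offEdges D v` (`m′ = |E′| = m − d(v)`), `Y = Σ_{p ∈ R} |avoid p|` and
`outDeg D v c` = the number of pairs of `R` starting at `c` (= the edges of `E′` at `c`):
`outDeg_add_deg_le_card_of_adj` (a neighbour `c` of `v` has `outDeg c + d(v) ≤ k`); `outDeg_le_card_avoid_add_two`
(a pair off `v` not at `c` is avoided by all but `≤ 2` of the edges at `c`);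
`two_mul_outDeg_le_card_filter_at_avoid_add_four` (an edge off `v` not at `c` avoids all but `≤ 4` of the pairs
at `c`) and `sum_avoid_at_eq_sum_edges` (the defect sum over the pairs at `c`, transposed);
**`sum_avoid_ge_of_outDeg`** — `(|R| − 2δ)(δ − 2) + (m′ − δ)(2δ − 4) ≤ Y` for `δ = outDeg c`;
**`sum_avoid_ge_of_outDeg_le`** — `|R|·(m′ + 1 − 2b) ≤ Y` when every off-degree is `≤ b`;
**`four_le_sum_avoid_of_card_lt`** — with `m > k`, `≥ 4` edges off `v` and a matching pair, `Y ≥ 4` (two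
disjoint edges off `v`, or a common vertex — which would force `m ≤ k`).  Axioms: standard.
-/

namespace PercRepro

namespace TriangleCap

namespace C047

open Finset

variable {V : Type*} [Fintype V] [DecidableEq V]

/-- The number of pairs off `v` starting at `c` (the degree of `c` in the graph off `v`). -/
def outDeg (D : SimpleGraph V) [DecidableRel D.Adj] (v c : V) : ℕ :=
  ((offPairs D v).filter (fun p => p.1 = c)).card

/-- As many pairs off `v` end at `c` as start at `c`. -/
theorem card_filter_snd_eq_outDeg (D : SimpleGraph V) [DecidableRel D.Adj] (v c : V) :
    ((offPairs D v).filter (fun p => p.2 = c)).card = outDeg D v c := by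
  unfold outDeg
  apply card_nbij' Prod.swap Prod.swap
  · intro p hp
    simp only [mem_coe, mem_filter, Prod.fst_swap] at hp ⊢
    exact ⟨swap_mem_offPairs D v hp.1, hp.2⟩
  · intro p hp
    simp only [mem_coe, mem_filter, Prod.snd_swap] at hp ⊢
    exact ⟨swap_mem_offPairs D v hp.1, hp.2⟩
  · intro p _
    exact Prod.swap_swap p
  · intro p _
    exact Prod.swap_swap p

/-- The edges off `v` at `c` are the pairs off `v` starting at `c`. -/
theorem card_offEdges_filter_mem_eq_outDeg (D : SimpleGraph V) [DecidableRel D.Adj] (v c : V) :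
    ((offEdges D v).filter (fun e => c ∈ e)).card = outDeg D v c := by
  unfold outDeg
  symm
  apply card_bij (fun p _ => s(p.1, p.2))
  · intro p hp
    rw [mem_filter] at hp
    rw [mem_filter]
    refine ⟨mk_mem_offEdges_of_mem_offPairs D v hp.1, ?_⟩
    rw [hp.2]
    exact Sym2.mem_mk_left _ _
  · intro p hp p' hp' he
    rw [mem_filter] at hp hp'
    rw [Sym2.eq_iff] at he
    rcases he with ⟨h1, h2⟩ | ⟨h1, h2⟩
    · exact Prod.ext h1 h2
    · exfalso
      have hne := D.ne_of_adj ((mem_offPairs D v p).mp hp.1).1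
      exact hne (by rw [hp.2, ← hp'.2, ← h2])
  · intro e he
    rw [mem_filter] at he
    obtain ⟨x, rfl⟩ := Sym2.mem_iff_exists.mp he.2
    rw [mem_offEdges] at he
    have hadj : D.Adj c x := D.mem_edgeSet.mp (SimpleGraph.mem_edgeFinset.mp he.1.1)
    refine ⟨(c, x), ?_, rfl⟩
    rw [mem_filter, mem_offPairs]
    exact ⟨⟨hadj, fun h => he.1.2 (h ▸ Sym2.mem_mk_left c x), fun h => he.1.2 (h ▸ Sym2.mem_mk_right c x)⟩,
      rfl⟩

/-- `|E′ off c| + outDeg c = m′`. -/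
theorem card_filter_not_mem_offEdges (D : SimpleGraph V) [DecidableRel D.Adj] (v c : V) :
    ((offEdges D v).filter (fun e => c ∉ e)).card + outDeg D v c = (offEdges D v).card := by
  rw [← card_offEdges_filter_mem_eq_outDeg, add_comm]
  exact card_filter_add_card_filter_not _

/-- At most `2 · outDeg c` pairs off `v` are at `c`. -/
theorem card_filter_at_le (D : SimpleGraph V) [DecidableRel D.Adj] (v c : V) :
    ((offPairs D v).filter (fun p => p.1 = c ∨ p.2 = c)).card ≤ 2 * outDeg D v c := by
  rw [filter_or]
  refine (card_union_le _ _).trans ?_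
  rw [card_filter_snd_eq_outDeg]
  unfold outDeg
  omega

/-- `outDeg c ≤ d(c)`. -/
theorem outDeg_le_deg (D : SimpleGraph V) [DecidableRel D.Adj] (v c : V) : outDeg D v c ≤ deg D c := by
  unfold outDeg deg
  apply card_le_card_of_injOn Prod.snd
  · intro p hp
    rw [mem_coe, mem_filter, mem_offPairs] at hp
    rw [mem_coe, mem_filter]
    exact ⟨mem_univ _, hp.2 ▸ hp.1.1⟩
  · intro p hp p' hp' he
    rw [mem_coe, mem_filter] at hp hp'
    exact Prod.ext (hp.2.trans hp'.2.symm) he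

/-- A neighbour `c` of `v` has `outDeg c + d(v) ≤ k`: its off-neighbours are its unique partner inside `N(v)`
(the matching property) or vertices outside `N(v) ∪ {v}`. -/
theorem outDeg_add_deg_le_card_of_adj (D : SimpleGraph V) [DecidableRel D.Adj] (hK : K4mFree D) {v c : V}
    (hvc : D.Adj v c) : outDeg D v c + deg D v ≤ Fintype.card V := by
  -- the off-neighbours of `c`
  have hsub : ((offPairs D v).filter (fun p => p.1 = c)).image Prod.snd ⊆
      (univ.filter (fun x => D.Adj v x)).filter (fun x => D.Adj c x) ∪
        (univ.filter (fun x => ¬ D.Adj v x)).erase v := by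
    intro x hx
    rw [mem_image] at hx
    obtain ⟨p, hp, rfl⟩ := hx
    rw [mem_filter, mem_offPairs] at hp
    rw [mem_union, mem_filter, mem_filter, mem_erase, mem_filter]
    by_cases hvx : D.Adj v p.2
    · exact Or.inl ⟨⟨mem_univ _, hvx⟩, hp.2 ▸ hp.1.1⟩
    · exact Or.inr ⟨hp.1.2.2, mem_univ _, hvx⟩
  have hinj : Set.InjOn Prod.snd (((offPairs D v).filter (fun p => p.1 = c) : Finset (V × V)) : Set (V × V)) := by
    intro p hp p' hp' he
    rw [mem_coe, mem_filter] at hp hp'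
    exact Prod.ext (hp.2.trans hp'.2.symm) he
  have h1 := card_le_card hsub
  rw [card_image_of_injOn hinj] at h1
  have h2 := (card_union_le _ _).trans' h1
  have h3 := card_filter_adj_neighbors_le_one D hK hvc
  have h4 : ((univ.filter (fun x => ¬ D.Adj v x)).erase v).card + 1 + deg D v = Fintype.card V := by
    have hvmem : v ∈ univ.filter (fun x => ¬ D.Adj v x) := mem_filter.mpr ⟨mem_univ _, D.irrefl⟩
    rw [card_erase_add_one hvmem]
    have := card_filter_add_card_filter_not (s := (univ : Finset V)) (fun x => D.Adj v x)
    rw [card_univ] at this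
    unfold deg
    omega
  unfold outDeg
  omega

/-- A pair off `v` not at `c` is avoided by all but at most two of the edges at `c`. -/
theorem outDeg_le_card_avoid_add_two (D : SimpleGraph V) [DecidableRel D.Adj] (v c : V) {p : V × V}
    (h1 : p.1 ≠ c) (h2 : p.2 ≠ c) : outDeg D v c ≤ (avoid D v p).card + 2 := by
  set A := ((offPairs D v).filter (fun q => q.1 = c)).filter (fun q => ¬ (q.2 = p.1 ∨ q.2 = p.2)) with hA
  have hsub : A.image (fun q => s(q.1, q.2)) ⊆ avoid D v p := by
    intro e he
    rw [mem_image] at he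
    obtain ⟨q, hq, rfl⟩ := he
    rw [hA, mem_filter, mem_filter] at hq
    push Not at hq
    have hqR := hq.1.1
    rw [mem_offPairs] at hqR
    rw [mem_avoid]
    refine ⟨SimpleGraph.mem_edgeFinset.mpr hqR.1, ?_, ?_, ?_⟩
    · intro hm
      rcases Sym2.mem_iff.mp hm with hm | hm
      · exact hqR.2.1 hm.symm
      · exact hqR.2.2 hm.symm
    · intro hm
      rcases Sym2.mem_iff.mp hm with hm | hm
      · exact h1 (hm.trans hq.1.2)
      · exact hq.2.1 hm.symm
    · intro hm
      rcases Sym2.mem_iff.mp hm with hm | hm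
      · exact h2 (hm.trans hq.1.2)
      · exact hq.2.2 hm.symm
  have hinj : Set.InjOn (fun q : V × V => s(q.1, q.2)) (A : Set (V × V)) := by
    intro q hq q' hq' he
    rw [mem_coe, hA, mem_filter, mem_filter] at hq hq'
    simp only at he
    rw [Sym2.eq_iff] at he
    rcases he with ⟨e1, e2⟩ | ⟨e1, e2⟩
    · exact Prod.ext e1 e2
    · exfalso
      have hne := D.ne_of_adj ((mem_offPairs D v q).mp hq.1.1).1
      exact hne (by rw [hq.1.2, ← hq'.1.2, ← e2])
  have hcard := card_image_of_injOn hinj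
  have hle := card_le_card hsub
  have hF : (((offPairs D v).filter (fun q => q.1 = c)).filter (fun q => q.2 = p.1 ∨ q.2 = p.2)).card ≤ 2 := by
    refine (card_le_card_of_injOn Prod.snd (t := {p.1, p.2}) ?_ ?_).trans card_le_two
    · intro q hq
      rw [mem_coe, mem_filter] at hq
      rw [mem_coe, mem_insert, mem_singleton]
      exact hq.2
    · intro q hq q' hq' he
      rw [mem_coe, mem_filter, mem_filter] at hq hq'
      exact Prod.ext (hq.1.2.trans hq'.1.2.symm) he
  have hsplit := card_filter_add_card_filter_not (s := (offPairs D v).filter (fun q => q.1 = c))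
    (fun q => q.2 = p.1 ∨ q.2 = p.2)
  rw [← hA] at hsplit
  unfold outDeg
  omega

/-- An edge `f` off `v` not at `c` avoids all but at most four of the pairs at `c`: `2 · outDeg c ≤ #{p at c :
f ∈ avoid p} + 4`. -/
theorem two_mul_outDeg_le_card_filter_at_avoid_add_four (D : SimpleGraph V) [DecidableRel D.Adj] (v c : V)
    {f : Sym2 V} (hf : f ∈ offEdges D v) (hcf : c ∉ f) :
    2 * outDeg D v c ≤
      (((offPairs D v).filter (fun p => p.1 = c ∨ p.2 = c)).filter (fun p => f ∈ avoid D v p)).card + 4 := by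
  have hfE := hf
  rw [mem_offEdges] at hfE
  have hA : ((offPairs D v).filter (fun p => p.1 = c)).filter (fun p => p.2 ∉ f) ∪
      ((offPairs D v).filter (fun p => p.2 = c)).filter (fun p => p.1 ∉ f) ⊆
      ((offPairs D v).filter (fun p => p.1 = c ∨ p.2 = c)).filter (fun p => f ∈ avoid D v p) := by
    intro p hp
    rw [mem_union, mem_filter, mem_filter, mem_filter, mem_filter] at hp
    rw [mem_filter, mem_filter, mem_avoid]
    rcases hp with ⟨⟨hpR, hp1⟩, hp2⟩ | ⟨⟨hpR, hp2⟩, hp1⟩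
    · exact ⟨⟨hpR, Or.inl hp1⟩, hfE.1, hfE.2, hp1 ▸ hcf, hp2⟩
    · exact ⟨⟨hpR, Or.inr hp2⟩, hfE.1, hfE.2, hp1, hp2 ▸ hcf⟩
  have hdisj : Disjoint (((offPairs D v).filter (fun p => p.1 = c)).filter (fun p => p.2 ∉ f))
      (((offPairs D v).filter (fun p => p.2 = c)).filter (fun p => p.1 ∉ f)) := by
    rw [disjoint_left]
    intro p hp hp'
    rw [mem_filter, mem_filter] at hp hp'
    have hne := D.ne_of_adj ((mem_offPairs D v p).mp hp.1.1).1
    exact hne (hp.1.2.trans hp'.1.2.symm)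
  have h1 := card_le_card hA
  rw [card_union_of_disjoint hdisj] at h1
  -- the pairs at `c` with the other end in `f` number at most two on each side
  have hF1 : (((offPairs D v).filter (fun p => p.1 = c)).filter (fun p => p.2 ∈ f)).card ≤ 2 := by
    revert hf hfE hcf hA hdisj h1
    refine Sym2.ind (fun a b => ?_) f
    intro _ _ _ _ _ _
    refine (card_le_card_of_injOn Prod.snd (t := {a, b}) ?_ ?_).trans card_le_two
    · intro q hq
      rw [mem_coe, mem_filter] at hq
      rw [mem_coe, mem_insert, mem_singleton]
      exact Sym2.mem_iff.mp hq.2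
    · intro q hq q' hq' he
      rw [mem_coe, mem_filter, mem_filter] at hq hq'
      exact Prod.ext (hq.1.2.trans hq'.1.2.symm) he
  have hF2 : (((offPairs D v).filter (fun p => p.2 = c)).filter (fun p => p.1 ∈ f)).card ≤ 2 := by
    revert hf hfE hcf hA hdisj h1 hF1
    refine Sym2.ind (fun a b => ?_) f
    intro _ _ _ _ _ _ _
    refine (card_le_card_of_injOn Prod.fst (t := {a, b}) ?_ ?_).trans card_le_two
    · intro q hq
      rw [mem_coe, mem_filter] at hq
      rw [mem_coe, mem_insert, mem_singleton]
      exact Sym2.mem_iff.mp hq.2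
    · intro q hq q' hq' he
      rw [mem_coe, mem_filter, mem_filter] at hq hq'
      exact Prod.ext he (hq.1.2.trans hq'.1.2.symm)
  have hs1 := card_filter_add_card_filter_not (s := (offPairs D v).filter (fun p => p.1 = c))
    (fun p => p.2 ∈ f)
  have hs2 := card_filter_add_card_filter_not (s := (offPairs D v).filter (fun p => p.2 = c))
    (fun p => p.1 ∈ f)
  have hout := card_filter_snd_eq_outDeg D v c
  unfold outDeg at hout ⊢
  omega

/-- The defect sum over the pairs at `c`, transposed: a sum over the edges off `v`. -/
theorem sum_avoid_at_eq_sum_edges (D : SimpleGraph V) [DecidableRel D.Adj] (v c : V) :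
    ∑ p ∈ (offPairs D v).filter (fun p => p.1 = c ∨ p.2 = c), (avoid D v p).card =
      ∑ f ∈ offEdges D v,
        (((offPairs D v).filter (fun p => p.1 = c ∨ p.2 = c)).filter (fun p => f ∈ avoid D v p)).card := by
  have h : ∀ p, (avoid D v p).card = ((offEdges D v).filter (fun f => f ∈ avoid D v p)).card := by
    intro p
    congr 1
    ext f
    rw [mem_filter, mem_avoid, mem_offEdges]
    tauto
  simp_rw [h, card_filter]
  exact sum_comm

/-- The pairs at `c` carry a defect sum of at least `(m′ − δ)(2δ − 4)`. -/
theorem sum_avoid_at_ge (D : SimpleGraph V) [DecidableRel D.Adj] (v c : V) :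
    ((offEdges D v).card - outDeg D v c) * (2 * outDeg D v c - 4) ≤
      ∑ p ∈ (offPairs D v).filter (fun p => p.1 = c ∨ p.2 = c), (avoid D v p).card := by
  rw [sum_avoid_at_eq_sum_edges]
  have h1 : ∑ f ∈ (offEdges D v).filter (fun f => c ∉ f),
      (((offPairs D v).filter (fun p => p.1 = c ∨ p.2 = c)).filter (fun p => f ∈ avoid D v p)).card ≤
      ∑ f ∈ offEdges D v,
        (((offPairs D v).filter (fun p => p.1 = c ∨ p.2 = c)).filter (fun p => f ∈ avoid D v p)).card :=
    sum_le_sum_of_subset (filter_subset _ _)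
  have h2 := card_nsmul_le_sum ((offEdges D v).filter (fun f => c ∉ f))
    (fun f => (((offPairs D v).filter (fun p => p.1 = c ∨ p.2 = c)).filter (fun p => f ∈ avoid D v p)).card)
    (2 * outDeg D v c - 4) (fun f hf => by
      rw [mem_filter] at hf
      have := two_mul_outDeg_le_card_filter_at_avoid_add_four D v c hf.1 hf.2
      omega)
  have h3 := card_filter_not_mem_offEdges D v c
  rw [smul_eq_mul] at h2
  have h4 : ((offEdges D v).filter (fun f => c ∉ f)).card = (offEdges D v).card - outDeg D v c := by omega
  rw [h4] at h2
  exact h2.trans h1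

/-- The pairs not at `c` carry a defect sum of at least `(|R| − 2δ)(δ − 2)`. -/
theorem sum_avoid_not_at_ge (D : SimpleGraph V) [DecidableRel D.Adj] (v c : V) :
    ((offPairs D v).card - 2 * outDeg D v c) * (outDeg D v c - 2) ≤
      ∑ p ∈ (offPairs D v).filter (fun p => ¬ (p.1 = c ∨ p.2 = c)), (avoid D v p).card := by
  have h2 := card_nsmul_le_sum ((offPairs D v).filter (fun p => ¬ (p.1 = c ∨ p.2 = c)))
    (fun p => (avoid D v p).card) (outDeg D v c - 2) (fun p hp => by
      rw [mem_filter] at hp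
      push Not at hp
      have := outDeg_le_card_avoid_add_two D v c hp.2.1 hp.2.2
      omega)
  rw [smul_eq_mul] at h2
  have h3 := card_filter_add_card_filter_not (s := offPairs D v) (fun p => p.1 = c ∨ p.2 = c)
  have h4 := card_filter_at_le D v c
  have h5 : (offPairs D v).card - 2 * outDeg D v c ≤
      ((offPairs D v).filter (fun p => ¬ (p.1 = c ∨ p.2 = c))).card := by omega
  exact (Nat.mul_le_mul_right _ h5).trans h2

/-- **The defect sum seen from `c`:** `(|R| − 2δ)(δ − 2) + (m′ − δ)(2δ − 4) ≤ Y` with `δ = outDeg c`. -/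
theorem sum_avoid_ge_of_outDeg (D : SimpleGraph V) [DecidableRel D.Adj] (v c : V) :
    ((offPairs D v).card - 2 * outDeg D v c) * (outDeg D v c - 2) +
        ((offEdges D v).card - outDeg D v c) * (2 * outDeg D v c - 4) ≤
      ∑ p ∈ offPairs D v, (avoid D v p).card := by
  have h := sum_filter_add_sum_filter_not (offPairs D v) (fun p => p.1 = c ∨ p.2 = c)
    (fun p => (avoid D v p).card)
  have hA := sum_avoid_not_at_ge D v c
  have hB := sum_avoid_at_ge D v c
  omega

/-- `m′ + 1 ≤ |avoid p| + outDeg p.1 + outDeg p.2`: the edges off `v` meeting `p` are at `p.1` or at `p.2`, and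
`s(p.1, p.2)` is at both. -/
theorem card_offEdges_add_one_le (D : SimpleGraph V) [DecidableRel D.Adj] (v : V) {p : V × V}
    (hp : p ∈ offPairs D v) :
    (offEdges D v).card + 1 ≤ (avoid D v p).card + outDeg D v p.1 + outDeg D v p.2 := by
  have hs := card_filter_add_card_filter_not (s := offEdges D v) (fun e => p.1 ∉ e ∧ p.2 ∉ e)
  have heq : (offEdges D v).filter (fun e => p.1 ∉ e ∧ p.2 ∉ e) = avoid D v p := by
    ext e
    rw [mem_filter, mem_offEdges, mem_avoid]
    tauto
  rw [heq] at hs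
  have hsub : (offEdges D v).filter (fun e => ¬ (p.1 ∉ e ∧ p.2 ∉ e)) ⊆
      (offEdges D v).filter (fun e => p.1 ∈ e) ∪ (offEdges D v).filter (fun e => p.2 ∈ e) := by
    intro e he
    rw [mem_filter] at he
    rw [mem_union, mem_filter, mem_filter]
    push Not at he
    tauto
  have hu := card_union_add_card_inter ((offEdges D v).filter (fun e => p.1 ∈ e))
    ((offEdges D v).filter (fun e => p.2 ∈ e))
  have hmem : s(p.1, p.2) ∈ (offEdges D v).filter (fun e => p.1 ∈ e) ∩
      (offEdges D v).filter (fun e => p.2 ∈ e) := by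
    rw [mem_inter, mem_filter, mem_filter]
    have := mk_mem_offEdges_of_mem_offPairs D v hp
    exact ⟨⟨this, Sym2.mem_mk_left _ _⟩, this, Sym2.mem_mk_right _ _⟩
  have hpos := card_pos.mpr ⟨_, hmem⟩
  have h1 := card_le_card hsub
  rw [card_offEdges_filter_mem_eq_outDeg, card_offEdges_filter_mem_eq_outDeg] at hu
  omega

/-- **With every off-degree `≤ b`:** `|R| · (m′ + 1 − 2b) ≤ Y`. -/
theorem sum_avoid_ge_of_outDeg_le (D : SimpleGraph V) [DecidableRel D.Adj] (v : V) (b : ℕ)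
    (hb : ∀ u, outDeg D v u ≤ b) :
    (offPairs D v).card * ((offEdges D v).card + 1 - 2 * b) ≤ ∑ p ∈ offPairs D v, (avoid D v p).card := by
  have := card_nsmul_le_sum (offPairs D v) (fun p => (avoid D v p).card) ((offEdges D v).card + 1 - 2 * b)
    (fun p hp => by
      have h1 := card_offEdges_add_one_le D v hp
      have h2 := hb p.1
      have h3 := hb p.2
      omega)
  rw [smul_eq_mul] at this
  exact this

/-- **`Y ≥ 4` whenever `m > k`, with `≥ 4` edges off `v` and a matching pair:** two disjoint edges off `v`, or a
common vertex `c` of the edges off `v` — then `c ∈ N(v)` and `m − d(v) ≤ outDeg c ≤ k − d(v)`. -/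
theorem four_le_sum_avoid_of_card_lt (D : SimpleGraph V) [DecidableRel D.Adj] (hK : K4mFree D) (v : V)
    (hE4 : 4 ≤ (offEdges D v).card) (hT : 0 < ((offPairs D v).filter (fun p => D.Adj v p.1 ∧ D.Adj v p.2)).card)
    (hm : Fintype.card V < D.edgeFinset.card) :
    4 ≤ ∑ p ∈ offPairs D v, (avoid D v p).card := by
  by_cases hpa : ∀ e ∈ offEdges D v, ∀ f ∈ offEdges D v, e ≠ f → ∃ x, x ∈ e ∧ x ∈ f
  · exfalso
    obtain ⟨c, hc⟩ := exists_common_vertex_of_pairwise_inter D (offEdges D v)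
      (fun e he => ((mem_offEdges D v e).mp he).1) hpa hE4
    obtain ⟨p, hp⟩ := card_pos.mp hT
    rw [mem_filter] at hp
    have hpE := mk_mem_offEdges_of_mem_offPairs D v hp.1
    have hcp := hc _ hpE
    have hvc : D.Adj v c := by
      rcases Sym2.mem_iff.mp hcp with rfl | rfl
      · exact hp.2.1
      · exact hp.2.2
    have h1 := outDeg_add_deg_le_card_of_adj D hK hvc
    have h2 : (offEdges D v).card ≤ outDeg D v c := by
      rw [← card_offEdges_filter_mem_eq_outDeg]
      apply card_le_card
      intro e he
      exact mem_filter.mpr ⟨he, hc e he⟩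
    have h3 := card_offEdges D v
    have h4 : deg D v ≤ D.edgeFinset.card := by
      rw [deg_eq_card_incidenceFinset]
      exact card_le_card (D.incidenceFinset_subset v)
    omega
  · push Not at hpa
    obtain ⟨e₁, he₁, e₂, he₂, -, hdisj⟩ := hpa
    exact four_le_sum_avoid_of_disjoint_edges D v he₁ he₂ hdisj

end C047

end TriangleCap

end PercRepro
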